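import Literature.Computability.AlgebraicComplexity.AlmanLi2026CwPrimeTensor
import Literature.Computability.AlgebraicComplexity.AlmanLi2026IteratedCWDischarge
import HarnessLib

/-!
# Cor. 7.2 of Alman–Li 2026: `R̃(cw'_2) ≤ γ'_2 < 3.931` over fields of characteristic `≠ 2`

Topic `Literature/Computability/AlgebraicComplexity` (family `MatrixMultiplication`). Source: J. Alman,
B. Li, *Asymptotic Rank Speedup Theorems, Revisited*, arXiv:2605.21738 (2026), Cor. 7.2 (held text
`paper:arxiv-2605.21738`, p0018 L1–3): "If `𝔽` has characteristic `≠ 2`, then we also have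
`R̃(cw'_2) ≤ γ'_2`", where `γ'_2` (Table 1: `3.931`) is the value of `max_{θ∈[2/3,1]} F(θ)^{1/n}` at
`q = 2`, `n = 4` of the §7.1 display (p0017 L100–122), and `cw'_2` is the symmetric variant
`x₁y₂z₃ + ⋯ + x₃y₂z₁` with its rank-`4` expression over characteristic `≠ 2` (p0017 L124–140; tree
`cwPrimeTensor`, `AlmanLi2026.cwPrimeTensor_rankData`).

The printed proof is the one of Thm. 1.3 with the border-rank identity of `cw_2` replaced by the
honest rank-`4` decomposition of `cw'_2`: the four linear forms `a_l` admit nonzero scalars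
`c' = (1,1,−1,−1)` with `rank ∑ c'_l a_l a_lᵀ = 2` (the analogue of Lemma 7.1), so Thm. 6.1 / Thm. 6.2
apply to the Kronecker powers with the SAME parameters `r = 4^n`, `s = 2^n`, `t = 4^n − 2·3^n + 2^n`
as for `cw_2`, and the Strassen calculus of §7.1 gives the same `γ'_2`.  Because the decomposition is
`λ`-free, this file uses the tree's `λ`-free Thm. 6.2 (`AlmanLi2026.thm62_rankDecomposition`,
`AlmanLi2026IteratedFreeLunch`) directly over `K` — no bootstrapping — and then the relabelling
assembly and the certificate exactly as for `cw_2` (`AlmanLi2026.assemble_direction`,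
`AlmanLi2026.asymptoticRank_le_of_iterated_certificate`, `AlmanLi2026.gammaPrime_two_certificate`).

## What is formalised (everything PROVED; no definitions, no named facts)

* `AlmanLi2026.thm62_cwPrime` — the iterated degeneration for `cw'_2` over any field with `2 ≠ 0`,
  all `n`: `(⟨4^n⟩ ⊕ ⟨1,2^n,1⟩)^{⊠2} ⊵ (cw'_2^{⊠n} ⊕ ⟨1,t,1⟩)^{⊠2}∖(⟨1,t,1⟩^{⊠2}) ⊕ ⟨1,t²+2·3^{2n},1⟩`
  (engine coordinates, as `thm62_cw`).
* `AlmanLi2026.iteratedSpeedup_cwPrime` — the same in the three displayed directions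
  `⟨·,1,1⟩ / ⟨1,·,1⟩ / ⟨1,1,·⟩` (the shape of the tree's fact `AlmanLi2026_iteratedSpeedup_cw`, for
  `cw'_2`), by `cw'_2`'s cyclic symmetry.
* **`AlmanLi2026.cor72`** — Cor. 7.2: `R̃(cw'_2) ≤ 238.7878^{1/4}` and `R̃(cw'_2) < 3.931` over every
  field `K` with `(2 : K) ≠ 0` (`AlmanLi2026.asymptoticRank_cwPrimeTensor_lt`).  The printed `γ'_2` is
  the exact maximum; the tree records it, as for Thm. 1.3, by the certificate `c = 238.7878 < 3.931⁴`.

## References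

* J. Alman, B. Li, *Asymptotic Rank Speedup Theorems, Revisited*, arXiv:2605.21738 (2026), Cor. 7.2
  (p0018 L1–3), §7.1 (p0017 L100–140), Thm. 6.2. [AlmanLi2026]
* M. Bläser, *Fast Matrix Multiplication*, ToC Graduate Surveys 5 (2013), Lemma 5.5 / Def. 7.2
  (permuting modes; relabelling restrictions). [Blaser2013]
-/

noncomputable section

open scoped BigOperators

namespace Literature.Computability.AlgebraicComplexity

namespace AlmanLi2026

section Rotations

variable {K : Type} [CommSemiring K] {ι κ μ ι' κ' μ' : Type*}

/-- `rotate (s ⊕ t) = rotate s ⊕ rotate t`. [folklore] -/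
private theorem rotate_directSum₃ (s : ι → κ → μ → K) (t : ι' → κ' → μ' → K) :
    rotate (directSumTensor s t) = directSumTensor (rotate s) (rotate t) := by
  funext b c a
  rcases a with a | a <;> rcases b with b | b <;> rcases c with c | c <;> rfl

/-- `rotate (s ⊠ t) = rotate s ⊠ rotate t`. [folklore] -/
private theorem rotate_kronecker₃ (s : ι → κ → μ → K) (t : ι' → κ' → μ' → K) :
    rotate (kroneckerTensor s t) = kroneckerTensor (rotate s) (rotate t) := by
  funext b c a
  simp [rotate_apply, kroneckerTensor_apply]

/-- `rotate ⟨n⟩ = ⟨n⟩`. [folklore] -/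
private theorem rotate_unit₃ (n : ℕ) : rotate (unitTensor K n) = unitTensor K n := by
  funext b c a
  simp only [rotate_apply, unitTensor_apply]
  exact if_congr ⟨fun ⟨h1, h2⟩ => ⟨h2, (h1.trans h2).symm⟩, fun ⟨h1, h2⟩ => ⟨(h1.trans h2).symm, h1⟩⟩
    rfl rfl

/-- `rotate (t^{⊠N}) = (rotate t)^{⊠N}`. [folklore] -/
private theorem rotate_kroneckerPow₃ (t : ι → κ → μ → K) (N : ℕ) :
    rotate (kroneckerPow t N) = kroneckerPow (rotate t) N := by
  funext b c a
  simp [rotate_apply, kroneckerPow_apply]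

omit [CommSemiring K] in
/-- `rotate³ = id`. [folklore] -/
private theorem rotate_rotate_rotate₃ (t : ι → κ → μ → K) : rotate (rotate (rotate t)) = t := rfl

end Rotations

section CorePrime

variable (K : Type) [Field K]

/-- **Thm. 6.2 applied to the rank-`4` decomposition of `cw'_2` (the degeneration behind Cor. 7.2),
over any field with `2 ≠ 0`.** For all `n` with `2·3^n ≤ 4^n + 2^n` (always true; it makes the
truncated subtractions exact), writing `t = 4^n + 2^n − 2·3^n`:
`(⟨4^n⟩ ⊕ ⟨1,2^n,1⟩)^{⊠2} ⊵ (cw'_2^{⊠n} ⊕ ⟨1,t,1⟩)^{⊠2}∖(⟨1,t,1⟩^{⊠2}) ⊕ ⟨1, t² + 2·3^{2n}, 1⟩`.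
Proof: the Kronecker power of the rank-`4` decomposition is a rank-`4^n` decomposition of
`cw'_2^{⊠n}`, the scalars `c'^{⊗n}` are nonzero and `rank (M^{⊗n}) ≤ 2^n`; apply the `λ`-free
Thm. 6.2 (`thm62_rankDecomposition`) and shrink the appended slice.
[cite: AlmanLi2026, Cor. 7.2 (proof: Thm. 6.2 on the rank-4 expression of cw'_2, §7.1)] -/
theorem thm62_cwPrime (h2 : (2 : K) ≠ 0) (n : ℕ) (h2N : 2 * 3 ^ n ≤ 4 ^ n + 2 ^ n) :
    AlgDegeneratesTo
      (kroneckerTensor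
        (directSumTensor (unitTensor K (4 ^ n)) (rotate (oneSliceTensor K (Fin (2 ^ n)))))
        (directSumTensor (unitTensor K (4 ^ n)) (rotate (oneSliceTensor K (Fin (2 ^ n))))))
      (directSumTensor
        (squareMinusCorner (kroneckerPow (cwPrimeTensor K) n)
          (rotate (oneSliceTensor K (Fin (4 ^ n + 2 ^ n - 2 * 3 ^ n)))))
        (rotate (oneSliceTensor K (Fin
          ((4 ^ n + 2 ^ n - 2 * 3 ^ n) ^ 2 + 2 * 3 ^ (2 * n)))))) := by
  classical
  obtain ⟨A, C₀, c', hdec, hc'0, hM1⟩ := cwPrimeTensor_rankData K h2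
  -- tensoring: decomposition of `cw'^{⊠n}` and `rank (M^{⊗n}) ≤ 2^n`
  have hTn : ∀ a b c, kroneckerPow (cwPrimeTensor K) n a b c = ∑ f : Fin n → Fin 4,
      (∏ l, A (a l) (f l)) * (∏ l, A (b l) (f l)) * ∏ l, C₀ (c l) (f l) :=
    kroneckerPow_eq_sum_decomposition (A := A) (B := A) (C := C₀) hdec n
  have hMn : (Matrix.of fun (a b : Fin n → Fin 3) => ∑ f : Fin n → Fin 4,
      (∏ l, A (a l) (f l)) * (∏ l, A (b l) (f l)) * ∏ l, c' (f l)).rank ≤ 2 ^ n := by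
    rw [contraction_pow_eq_powMatrix A A c' n]
    exact (rank_powMatrix_le _ n).trans (Nat.pow_le_pow_left hM1 n)
  -- reindex the decomposition by `Fin (4^n)`
  have e : (Fin n → Fin 4) ≃ Fin (4 ^ n) :=
    Fintype.equivFinOfCardEq (by rw [Fintype.card_fun, Fintype.card_fin, Fintype.card_fin])
  have hTn' : ∀ a b c, kroneckerPow (cwPrimeTensor K) n a b c = ∑ i : Fin (4 ^ n),
      (∏ l, A (a l) (e.symm i l)) * (∏ l, A (b l) (e.symm i l)) * ∏ l, C₀ (c l) (e.symm i l) :=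
    fun a b c => by rw [hTn, ← e.symm.sum_comp]
  have hMn' : (Matrix.of fun (a b : Fin n → Fin 3) => ∑ i : Fin (4 ^ n),
      (∏ l, A (a l) (e.symm i l)) * (∏ l, A (b l) (e.symm i l)) * ∏ l, c' (e.symm i l)).rank
        ≤ 2 ^ n := by
    have heq : (Matrix.of fun (a b : Fin n → Fin 3) => ∑ i : Fin (4 ^ n),
        (∏ l, A (a l) (e.symm i l)) * (∏ l, A (b l) (e.symm i l)) * ∏ l, c' (e.symm i l)) =
        Matrix.of fun (a b : Fin n → Fin 3) => ∑ f : Fin n → Fin 4,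
          (∏ l, A (a l) (f l)) * (∏ l, A (b l) (f l)) * ∏ l, c' (f l) := by
      ext a b
      rw [Matrix.of_apply, Matrix.of_apply]
      exact e.symm.sum_comp (fun f => (∏ l, A (a l) (f l)) * (∏ l, A (b l) (f l)) * ∏ l, c' (f l))
    rw [heq]
    exact hMn
  -- the slice size `t`
  have hcard : Fintype.card (Fin n → Fin 3) = 3 ^ n := by
    rw [Fintype.card_fun, Fintype.card_fin, Fintype.card_fin]
  set t := 4 ^ n + 2 ^ n - 2 * 3 ^ n with ht
  have htle : t ≤ 4 ^ n + 2 ^ n -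
      (Fintype.card (Fin n → Fin 3) + Fintype.card (Fin n → Fin 3)) := by
    rw [hcard]; omega
  -- Thm. 6.2, `λ`-free, over `K`
  have hdeg := thm62_rankDecomposition (K := K) (T := kroneckerPow (cwPrimeTensor K) n)
    (A := fun a i => ∏ l, A (a l) (e.symm i l)) (B := fun b i => ∏ l, A (b l) (e.symm i l))
    (C₀ := fun c i => ∏ l, C₀ (c l) (e.symm i l)) hTn' (c' := fun i => ∏ l, c' (e.symm i l))
    (fun i => prod_coeff_ne_zero hc'0 (e.symm i)) hMn' htle
  -- the appended slice size `t' = t² + 2·3^{2n}`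
  have ht'le : t ^ 2 + 2 * 3 ^ (2 * n) ≤ (4 ^ n + 2 ^ n) * (4 ^ n + 2 ^ n) -
      ((Fintype.card (Fin n → Fin 3) * Fintype.card (Fin n → Fin 3) +
          2 * (Fintype.card (Fin n → Fin 3) * t)) +
        (Fintype.card (Fin n → Fin 3) * Fintype.card (Fin n → Fin 3) +
          2 * (Fintype.card (Fin n → Fin 3) * t))) := by
    rw [hcard]
    have hsum : 4 ^ n + 2 ^ n = 2 * 3 ^ n + t := by omega
    have hsq : (2 * 3 ^ n + t) * (2 * 3 ^ n + t) =
        (t ^ 2 + 2 * 3 ^ (2 * n)) +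
          ((3 ^ n * 3 ^ n + 2 * (3 ^ n * t)) + (3 ^ n * 3 ^ n + 2 * (3 ^ n * t))) := by
      ring
    rw [hsum, hsq, Nat.add_sub_cancel]
  exact hdeg.trans_restrictsTo ((TensorRestrictsTo.refl _).directSum
    (tensorRestrictsTo_rotate_oneSliceTensor_of_le (K := K) ht'le))

/-- **The §7.1 iterated display for `cw'_2`, three directions** (the statement of the tree's fact
`AlmanLi2026_iteratedSpeedup_cw` with `cw_2` replaced by `cw'_2`, `q = 2`), over any field with
`2 ≠ 0`: for all `n, t` with `4^n + 2^n = 2·3^n + t` (i.e. `t = 4^n + 2^n − 2·3^n`, which is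
nonnegative by `AlmanLi2026.two_mul_pow_succ_le 2 n`),
`(⟨4^n⟩ ⊕ L_{2^n})^{⊠2} ⊵ cw'_2^{⊠2n} ⊕ ⟨2⟩⊠(cw'_2^{⊠n}⊠L_t) ⊕ L_{t²+2·3^{2n}}` for `L = ⟨·,1,1⟩`,
`⟨1,·,1⟩`, `⟨1,1,·⟩`. [cite: AlmanLi2026, Cor. 7.2 (proof), §7.1 (display after Cor. 7.1)] -/
theorem iteratedSpeedup_cwPrime (h2 : (2 : K) ≠ 0) {n t : ℕ}
    (ht : 4 ^ n + 2 ^ n = 2 * 3 ^ n + t) :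
    AlgDegeneratesTo
        (kroneckerTensor (directSumTensor (unitTensor K (4 ^ n)) (matMulTensor K (2 ^ n) 1 1))
          (directSumTensor (unitTensor K (4 ^ n)) (matMulTensor K (2 ^ n) 1 1)))
        (directSumTensor (kroneckerPow (cwPrimeTensor K) (2 * n)) (directSumTensor
          (kroneckerTensor (unitTensor K 2)
            (kroneckerTensor (kroneckerPow (cwPrimeTensor K) n) (matMulTensor K t 1 1)))
          (matMulTensor K (t ^ 2 + 2 * 3 ^ (2 * n)) 1 1))) ∧
      AlgDegeneratesTo
        (kroneckerTensor (directSumTensor (unitTensor K (4 ^ n)) (matMulTensor K 1 (2 ^ n) 1))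
          (directSumTensor (unitTensor K (4 ^ n)) (matMulTensor K 1 (2 ^ n) 1)))
        (directSumTensor (kroneckerPow (cwPrimeTensor K) (2 * n)) (directSumTensor
          (kroneckerTensor (unitTensor K 2)
            (kroneckerTensor (kroneckerPow (cwPrimeTensor K) n) (matMulTensor K 1 t 1)))
          (matMulTensor K 1 (t ^ 2 + 2 * 3 ^ (2 * n)) 1))) ∧
      AlgDegeneratesTo
        (kroneckerTensor (directSumTensor (unitTensor K (4 ^ n)) (matMulTensor K 1 1 (2 ^ n)))
          (directSumTensor (unitTensor K (4 ^ n)) (matMulTensor K 1 1 (2 ^ n))))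
        (directSumTensor (kroneckerPow (cwPrimeTensor K) (2 * n)) (directSumTensor
          (kroneckerTensor (unitTensor K 2)
            (kroneckerTensor (kroneckerPow (cwPrimeTensor K) n) (matMulTensor K 1 1 t)))
          (matMulTensor K 1 1 (t ^ 2 + 2 * 3 ^ (2 * n))))) := by
  obtain rfl : t = 4 ^ n + 2 ^ n - 2 * 3 ^ n := by omega
  classical
  have hK := thm62_cwPrime K h2 n (by omega)
  rw [squareMinusCorner_eq_directSum] at hK
  have hP := tensorRestrictsTo_kroneckerPow_two_mul (cwPrimeTensor K) n
  -- direction `⟨·,1,1⟩` (slices with trivial factor third, as produced)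
  have h₁ := assemble_direction hK (tensorRestrictsTo_matMul_rotate₁ (2 ^ n)) hP
    (tensorRestrictsTo_rotate₁_matMul _) (tensorRestrictsTo_rotate₁_matMul _)
  -- direction `⟨1,1,·⟩`: rotate once
  have hK₃ := algDegeneratesTo_rotate_modes hK
  simp only [rotate_kronecker₃, rotate_directSum₃, rotate_unit₃, rotate_kroneckerPow₃,
    rotate_cwPrimeTensor] at hK₃
  have h₃ := assemble_direction hK₃ (tensorRestrictsTo_matMul_rotate₂ (2 ^ n)) hP
    (tensorRestrictsTo_rotate₂_matMul _) (tensorRestrictsTo_rotate₂_matMul _)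
  -- direction `⟨1,·,1⟩`: rotate twice
  have hK₂ := algDegeneratesTo_rotate_modes (algDegeneratesTo_rotate_modes hK)
  simp only [rotate_kronecker₃, rotate_directSum₃, rotate_unit₃, rotate_kroneckerPow₃,
    rotate_cwPrimeTensor, rotate_rotate_rotate₃] at hK₂
  have h₂ := assemble_direction hK₂
    (tensorRestrictsTo_matMulTensor_oneSliceTensor (Function.Embedding.refl (Fin (2 ^ n)))) hP
    (tensorRestrictsTo_oneSliceTensor_matMulTensor (Equiv.refl _))
    (tensorRestrictsTo_oneSliceTensor_matMulTensor (Equiv.refl _))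
  exact ⟨h₁, h₂, h₃⟩

/-- **Alman–Li 2026, Cor. 7.2 (certificate form)**: over every field `K` with `(2 : K) ≠ 0`,
`R̃(cw'_2) ≤ 238.7878^{1/4}` (`= (max_θ F(θ))^{1/4}` up to the certificate's rounding; Table 1's
`γ'_2 = 3.931`). [cite: AlmanLi2026, Cor. 7.2] -/
theorem cor72 (h2 : (2 : K) ≠ 0) :
    asymptoticRank (cwPrimeTensor K) ≤ (1193939 / 5000 : ℝ) ^ ((4 : ℝ)⁻¹) := by
  obtain ⟨h₁, h₂, h₃⟩ := iteratedSpeedup_cwPrime K h2 (n := 4) (t := 110) (by norm_num)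
  have hle := asymptoticRank_le_of_iterated_certificate (cwPrimeTensor K) (r := 4 ^ 4)
    (s := 2 ^ 4) (t := 110) (t' := 110 ^ 2 + 2 * 3 ^ (2 * 4)) (n := 4) (by norm_num) (by norm_num)
    (by norm_num) (by norm_num) h₁ h₂ h₃ (c := (1193939 / 5000 : ℝ)) (by norm_num)
    (fun θ hθ₁ hθ₂ => by
      have hc := gammaPrime_two_certificate θ hθ₁ hθ₂
      push_cast
      norm_num
      linarith [hc])
  have h4 : ((4 : ℕ) : ℝ)⁻¹ = (4 : ℝ)⁻¹ := by norm_num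
  rw [h4] at hle
  exact hle

/-- **Alman–Li 2026, Cor. 7.2**: `R̃(cw'_2) ≤ γ'_2 < 3.931` over every field of characteristic `≠ 2`
(here: every field `K` with `(2 : K) ≠ 0`). [cite: AlmanLi2026, Cor. 7.2 (with Table 1: γ'_2 = 3.931)] -/
theorem asymptoticRank_cwPrimeTensor_lt (h2 : (2 : K) ≠ 0) :
    asymptoticRank (cwPrimeTensor K) < 3.931 :=
  (cor72 K h2).trans_lt gammaPrime_two_root_lt

end CorePrime

end AlmanLi2026

end Literature.Computability.AlgebraicComplexity
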